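import HarnessLib
import Summits.Ventures.WeilGRH.UniformConductorFloorPrincipal
import Summits.Ventures.WeilGRH.UniformConductorFloorCoprimeFloors57
import Summits.Ventures.WeilGRH.RealCharacterSmallModuli
import Summits.Ventures.WeilGRH.KCellsMod10OneA

/-!
# GRH arm (rh-explicit, venture WeilGRH): Weil positivity on `[−1, 1]` for EVERY non-principal Dirichlet character mod 10

Cell `rh-explicit`, WEIL TRACK — GRH ARM (engine seat weil-grh-2 gen16).  `(ℤ/10)ˣ = ⟨3⟩` (order 4), `χ(3) = ζ^i`, `ζ = exp(2πi/4) = i`: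
`i = 0` is the principal character (FAILS, `10 ∈ F`); `i = 2` (`χ(3) = −1`) is the lift of `(5/·)` — the checker-K χ-cell
`KCellsMod10OneA.weilPositivityOnChar_mod_ten_one_of_real_3n` (this generation; at level 5 itself the margin `≈ 2·10⁻⁶` is out of reach);
`i = 1, 3` are ODD (`χ(−1) = χ(3)² = −1`, the lifts of the quartic characters of conductor 5) — the divisibility floor
`UniformFloor.weilPositivityOnChar_one_of_odd_not_mem_remainder₂` (`10 ∉ R₁′`, weil-grh-1 gen8).  So at level 10 exactly the principal character
fails.  Pure assembly; RH/GRH-free; standard axioms.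
-/

noncomputable section

namespace Summit.Ventures.WeilGRH.OneCompleteMod10
open Literature.NumberTheory.LFunctions

/-- `(ℤ/10)ˣ = ⟨3⟩`. [folklore] -/
theorem units_mod10_gen : ∀ u : (ZMod 10)ˣ, ∃ k < 4, (u : ZMod 10) = 3 ^ k := by decide

/-- ★ **Every non-principal Dirichlet character mod 10 satisfies Weil positivity on `[−1, 1]`** (`WeilPositivityOnChar χ 1`); the
principal character mod 10 fails, so `χ ≠ 1` is sharp. [cite: Weil1952FormulesExplicites, (11) pp. 261–262 and the «lemme» p. 262] -/
theorem weilPositivityOnChar_mod10_one (χ : DirichletCharacter ℂ 10) (hχ : χ ≠ 1) : WeilPositivityOnChar χ 1 := by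
  have zeta4_sq : (Complex.exp (2 * ↑Real.pi * Complex.I / 4)) ^ 2 = -1 := by
    rw [← Complex.exp_nat_mul, show ((2 : ℕ) : ℂ) * (2 * ↑Real.pi * Complex.I / 4) = ↑Real.pi * Complex.I by push_cast; ring]
    exact Complex.exp_pi_mul_I
  rcases χ.even_or_odd with he | ho
  · have hz : χ (3 : ZMod 10) ^ 4 = 1 := by
      rw [← map_pow, show (3 : ZMod 10) ^ 4 = 1 from by decide, map_one]
    have hprim : IsPrimitiveRoot (Complex.exp (2 * ↑Real.pi * Complex.I / 4)) 4 := by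
      exact_mod_cast Complex.isPrimitiveRoot_exp 4 (by norm_num)
    obtain ⟨i, hi, hiz⟩ := hprim.eq_pow_of_pow_eq_one hz
    have hm1 : χ (-1) = (Complex.exp (2 * ↑Real.pi * Complex.I / 4)) ^ (i * 2) := by
      rw [pow_mul, hiz, ← map_pow, show (3 : ZMod 10) ^ 2 = -1 from by decide]
    have he1 : χ (-1) = 1 := he
    interval_cases i
    · exact absurd (RealCharacterSmallModuli.eq_one_of_apply_gen units_mod10_gen (by rw [← hiz, pow_zero])) hχ
    · exfalso; rw [hm1, show 1 * 2 = 2 from rfl, zeta4_sq] at he1; norm_num at he1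
    · exact KCellsMod10OneA.weilPositivityOnChar_mod_ten_one_of_real_3n χ (by rw [← hiz, zeta4_sq])
    · exfalso; rw [hm1, show 3 * 2 = 2 * 3 from rfl, pow_mul, zeta4_sq] at he1; norm_num at he1
  · exact UniformFloor.weilPositivityOnChar_one_of_odd_not_mem_remainder₂ (by decide) χ (charParity_of_odd ho)

/-- The same on every window `t ≤ 1`. [folklore] -/
theorem weilPositivityOnChar_of_le_one_mod10 (χ : DirichletCharacter ℂ 10) (hχ : χ ≠ 1) {t : ℝ} (ht : t ≤ 1) :
    WeilPositivityOnChar χ t := fun g hg hsupp ↦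
  weilPositivityOnChar_mod10_one χ hχ g hg (hsupp.trans (Set.Icc_subset_Icc (by linarith) ht))

/-- ★★ **At level 10 EXACTLY the principal character fails Weil positivity on `[−1, 1]`**: for every Dirichlet character `χ` mod 10,
`WeilPositivityOnChar χ 1 ↔ χ ≠ 1` (the principal character fails by the flat-window witness of
`UniformFloor.not_weilPositivityOnChar_one_principal`, `10 ∈ F`). [cite: Weil1952FormulesExplicites, (11) pp. 261–262 and the «lemme» p. 262] -/
theorem weilPositivityOnChar_one_iff_ne_one_mod10 (χ : DirichletCharacter ℂ 10) : WeilPositivityOnChar χ 1 ↔ χ ≠ 1 :=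
  ⟨fun h h1 ↦ UniformFloor.not_weilPositivityOnChar_one_principal (q := 10) (by decide) (h1 ▸ h), weilPositivityOnChar_mod10_one χ⟩

end Summit.Ventures.WeilGRH.OneCompleteMod10

end
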